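import Mathlib
import HarnessLib
import Literature.Dynamics.TransferOperators.MayerTransferOperatorExistence
import Summits.RiemannHypothesis.Statement
import Summits.RiemannHypothesis.RiemannHypothesis.Theses.MayerPairing
import Summits.RiemannHypothesis.RiemannHypothesis.Theorems.MayerPairingTarget
import Summits.RiemannHypothesis.RiemannHypothesis.Theorems.MayerPairingUnitCircleCrossedOnceBulge
import Summits.RiemannHypothesis.RiemannHypothesis.Theorems.MayerPairingEigenvaluePredicate

/-!
# `MayerPairing.Target` (item stmt-RiemannHypothesis-1473) — negative side:
# `¬ Target` modulo a certified bulging eigenvalue branch of Mayer's `L_s` at height `τ = 37.85`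

Route `RiemannHypothesis/MayerPairing`; prover seat `prover-…-MayerPairing-2`, 2026-08-16.
Sorry-free, axioms `propext`, `Classical.choice`, `Quot.sound`.

`Target = UnitCircleCrossedOnce ∧ BranchPairing`, and by
`mayerPairing_target_iff_unitCircleCrossedOnce_and_riemannHypothesis` (in tree) in fact
`Target ↔ UnitCircleCrossedOnce ∧ RiemannHypothesis`. The monotonicity crux `UnitCircleCrossedOnce`
(item 1470: no continuous selection of eigenvalues of `L_{σ+iτ}`, `|τ| ≥ 7`, over `[a, b] ⊂ (0, 1/2)`
has modulus `1` at both ends) is NUMERICALLY FALSE — route kill criterion K1 — with three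
independent implementations agreeing at two heights (evidence files on items 1470/1473:
`EVIDENCE.md` + `witness_37.8500_M129.json` of refuter-cdisprove-stmt-RiemannHypothesis-1470-0,
Chebyshev collocation, M = 89/129; Arb cross-check job j007284 of the g2 seat;
`K1_UnitCircleCrossedTwice_tau24.md`, `SESSION3_K1crosscheck_repaircensus.md` of this seat,
two-disc Taylor/Hurwitz code, N = 130…266, 22-digit agreement). A Lean proof of `¬ Target` needs
that eigenvalue branch as a CERTIFIED object, which the tree cannot yet construct (no validated
numerics for Hurwitz-zeta matrix entries, no eigenvalue-enclosure / continuation theory for compact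
operators in Mathlib). This file isolates exactly that object as a hypothesis `H` and proves
`H → ¬ Target`:

* `MayerBulgeWitness` — hypothesis `H` (the construction the item waits for): a continuous selection
  `Λ` of nonzero eigenvalues of `Literature.Dynamics.TransferOperators.mayerTransfer (σ + i·757/20)`
  on `B(D)` over `σ ∈ [1/50, 49/100]` with `‖Λ(1/50)‖ < 1 < ‖Λ(6/25)‖` and `‖Λ(49/100)‖ < 1`.
  Intended inhabitant: the branch through `Λ(0.1692965890) = 0.9161923273 + 0.4007388418 i` at
  `τ = 37.85`, whose modulus profile is `0.9212 (σ = .02) ↗ 1.0917 (σ = .24) ↘ 0.8969 (σ = .49)`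
  (margins `0.079 / 0.092 / 0.103`; Taylor truncations N = 150/170/200/230 agree to 12/18/20/20
  digits, N ≤ 110 fails; refuter's isolation from the rest of the spectrum ≥ 0.345 against
  continuation steps ≤ 0.0045; exceptional point at `0.19343 + 37.83032 i` just below).
* `not_unitCircleCrossedOnce_of_operator_bulge` — generic bridge: an operator-language bulge at any
  admissible `(τ, a, m, b)` refutes the crux (predicate audit `mayerPairing_isEigen_iff` + the
  intermediate-value interface `mayerPairing_not_unitCircleCrossedOnce_of_bulge`, both in tree).
* `unitCircleCrossedOnce_false_of_mayerBulgeWitness : H → ¬ UnitCircleCrossedOnce`.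
* `Target_false_of_MayerBulgeWitness : H → ¬ Target` — NEGATIVE LEMMA MODULO `H` (the item stays
  open on hold; `H` is the construction it waits for).

The second certified height, `τ = 24` (branch `0.9886 (σ = 0) ↗ 1.4036 (σ ≈ .158) ↘ 0.7664 (σ = ½)`,
crossings `a = 0.0229335`, `b = 0.3612464`; N = 88/110/120 and centre-3/2 N = 168 agree to 19
digits), is NOT used as `H`: its left margin `1 - |Λ(0⁺)| ≤ 0.012` makes it a poor certification
target. A witness certified at any other admissible `(τ, a, m, b)` plugs into
`not_unitCircleCrossedOnce_of_operator_bulge` + `mayerPairing_not_target_of_not_unitCircleCrossedOnce`.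
No repair is asserted here; the repair census is on the item (W1 = exact-left form alive at 30/30
zero heights; W2/W4 dead or RH-equivalent).
-/

namespace Summit.RiemannHypothesis.RiemannHypothesis.Theorems.MayerPairingTarget.Negative

open Filter Topology Complex
open Literature.Dynamics.TransferOperators
open Summit.RiemannHypothesis.RiemannHypothesis.Theses.MayerPairing
open Summit.RiemannHypothesis.RiemannHypothesis.Theorems

/-- **Hypothesis `H` (construction item): the certified K1 witness at height `τ = 37.85 = 757/20`.**
A continuous selection `Λ` of nonzero eigenvalues of Mayer's transfer operator
`L_{σ + 37.85 i}` on the Banach space `B(D)` over `σ ∈ [1/50, 49/100]` whose modulus is `< 1` at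
`σ = 1/50`, `> 1` at `σ = 6/25` and `< 1` at `σ = 49/100`. Numerically this is the eigenvalue branch
through `Λ(0.1692965890) = 0.9161923273 + 0.4007388418 i` (`|Λ| = 0.9212, 1.0917, 0.8969` at the
three abscissae; three independent codes, items 1470/1473). Not constructible in the tree today:
it needs certified enclosures of Hurwitz-zeta matrix entries and an eigenvalue-continuation
argument for the compact operator `mayerTransfer`. Source of the witness: item evidence
`EVIDENCE.md`/`witness_37.8500_M129.json` (refuter-cdisprove-stmt-RiemannHypothesis-1470-0) and
`SESSION3_K1crosscheck_repaircensus.md` (this seat) on items 1470/1473.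
[topic: Summits/RiemannHypothesis/RiemannHypothesis — certified spectral data of Mayer's transfer operator] -/
def MayerBulgeWitness : Prop :=
  ∃ Λ : ℝ → ℂ, ContinuousOn Λ (Set.Icc (1 / 50 : ℝ) (49 / 100)) ∧
    (∀ σ ∈ Set.Icc (1 / 50 : ℝ) (49 / 100), Λ σ ≠ 0 ∧ ∃ g : MayerSpace, g ≠ 0 ∧
      mayerTransfer ((σ : ℂ) + ((757 / 20 : ℝ) : ℂ) * I) g = Λ σ • g) ∧
    ‖Λ (1 / 50)‖ < 1 ∧ 1 < ‖Λ (6 / 25)‖ ∧ ‖Λ (49 / 100)‖ < 1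

/-- **Generic bridge (operator language → crux).** At any height `|τ| ≥ 7`, a continuous selection
of nonzero eigenvalues of `mayerTransfer (σ + iτ)` on `[a, b] ⊂ (0, 1/2)` with modulus `< 1` at `a`,
`> 1` at some interior `m`, `< 1` at `b` refutes `UnitCircleCrossedOnce`: translate each eigenpair
into the route's inlined three-term predicate (`mayerPairing_isEigen_iff`) and apply the
intermediate-value interface `mayerPairing_not_unitCircleCrossedOnce_of_bulge`. [folklore] -/
theorem not_unitCircleCrossedOnce_of_operator_bulge {τ a m b : ℝ} (hτ : 7 ≤ |τ|) (ha : 0 < a)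
    (ham : a < m) (hmb : m < b) (hb : b < 1 / 2) {Λ : ℝ → ℂ}
    (hΛ : ContinuousOn Λ (Set.Icc a b))
    (heig : ∀ σ ∈ Set.Icc a b, Λ σ ≠ 0 ∧ ∃ g : MayerSpace, g ≠ 0 ∧
      mayerTransfer ((σ : ℂ) + (τ : ℂ) * I) g = Λ σ • g)
    (h1 : ‖Λ a‖ < 1) (h2 : 1 < ‖Λ m‖) (h3 : ‖Λ b‖ < 1) : ¬ UnitCircleCrossedOnce := by
  refine mayerPairing_not_unitCircleCrossedOnce_of_bulge
    ⟨τ, hτ, a, m, b, ha, ham, hmb, hb, Λ, hΛ, fun σ hσ => ?_, h1, h2, h3⟩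
  obtain ⟨hs, hs'⟩ :=
    mayerPairing_param_ok (σ := σ) (τ := τ) (ha.trans_le hσ.1) (hσ.2.trans_lt hb)
  exact (mayerPairing_isEigen_iff hs hs').2 (heig σ hσ)

/-- `H` refutes the monotonicity crux `UnitCircleCrossedOnce` (item 1470). [folklore] -/
theorem unitCircleCrossedOnce_false_of_mayerBulgeWitness :
    MayerBulgeWitness → ¬ UnitCircleCrossedOnce := by
  rintro ⟨Λ, hΛ, heig, h1, h2, h3⟩
  have hτ : (7 : ℝ) ≤ |(757 / 20 : ℝ)| := by
    rw [abs_of_pos (by norm_num)]; norm_num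
  exact not_unitCircleCrossedOnce_of_operator_bulge hτ (by norm_num) (by norm_num) (by norm_num)
    (by norm_num) hΛ heig h1 h2 h3

/-- **NEGATIVE LEMMA MODULO `H`.** The certified bulging branch at `τ = 37.85` refutes the target
`Target = UnitCircleCrossedOnce ∧ BranchPairing` of route MayerPairing (item 1473). [folklore] -/
theorem Target_false_of_MayerBulgeWitness : MayerBulgeWitness → ¬ Target := fun h =>
  mayerPairing_not_target_of_not_unitCircleCrossedOnce
    (unitCircleCrossedOnce_false_of_mayerBulgeWitness h)

end Summit.RiemannHypothesis.RiemannHypothesis.Theorems.MayerPairingTarget.Negative
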